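import Mathlib
import Summits.MatrixMultiplication.Statement
import Summits.MatrixMultiplication.MatrixMultiplication.Theorems.GraphEquationsExactEngineThreeAlive

/-!
# Graph equations — the e = 3 rung in the EXACT-AFFINE-SECTIONS regime: garbage-free (M19q)

The residual of the e-ladder (the semi-forced reading, NODE-g32 REV 8/11/12) is produced by the TRUNCATION
ERROR of non-affine exact kernel sections: if the fields used ARE exact sections (`Σ_q ξ_q r_q(t_o) = 0`
identically) then every deflated output lies in `I` again (`derivC_mem_graphIdeal_of_exact`), the whole
output family stays in `I` at every level, and serving a coordinate by a row equation is garbage-free.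
Hence, in the regime where the row matrices of `t` and of `t ∪ D₁t` have exact AFFINE kernel sections
doing the job, cube members force the rank bound with the ROW dichotomy only
(`tensorRank_le_of_cubeMembers_exactAffine`): per coordinate, alive for `(ξ₁(0), ξ₂(0))` or ROW-FORCED in
the level-1 row matrix at `0`.

* `derivC_mem_graphIdeal_of_exact` — exact section ⇒ `D_ξ t ∈ I`;
* `oscNull_of_rowEq'` — `oscNull_of_rowEq` over an arbitrary finite index type;
* `tensorRank_le_of_cubeMembers_exactAffine` — the garbage-free e = 3 rung.
-/

set_option linter.dupNamespace false

noncomputable section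

open scoped BigOperators

namespace Summit.MatrixMultiplication.MatrixMultiplication.Theorems.GraphEquations

open MvPolynomial
open Literature.Computability.AlgebraicComplexity
open Literature.Computability.AlgebraicComplexity.ArithCircuit

variable {n : ℕ}

/-- **Exact sections deflate inside `I`.**  If `Σ_q ξ_q r_q(t) = 0` identically then `D_ξ t ∈ I`. -/
theorem derivC_mem_graphIdeal_of_exact (ξ : Fin n × Fin n → MvPolynomial (MatMulVars n) ℂ)
    (t : MvPolynomial (GraphVars n) ℂ) (hker : ∑ q, ξ q * rowPoly t q = 0) :
    derivC ξ t ∈ graphIdeal n := by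
  rw [mem_graphIdeal_iff_graphRestrict, graphRestrict_derivC, hker]

/-- **Row equation ⇒ served modulo osculation-null**, for a family in `I` over any finite index type. -/
theorem oscNull_of_rowEq' {ο : Type*} [Fintype ο] (t : ο → MvPolynomial (GraphVars n) ℂ)
    (ht : ∀ o, t o ∈ graphIdeal n) (P : ο → ℂ) (q : Fin n × Fin n)
    (hP : ∀ q' : Fin n × Fin n,
      ∑ o, P o * coeff (Finsupp.single (Sum.inr q' : GraphVars n) 1) (t o) = if q = q' then 1 else 0) :
    (∀ q' : Fin n × Fin n, coeff (Finsupp.single (Sum.inr q' : GraphVars n) 1)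
        (∑ o, C (P o) * t o - generator n q) = 0) ∧
      ∀ i j j' l : Fin n,
        coeff (Finsupp.single (Sum.inl (Sum.inl (i, j)) : GraphVars n) 1 +
            Finsupp.single (Sum.inl (Sum.inr (j', l)) : GraphVars n) 1)
          (∑ o, C (P o) * t o - generator n q) = 0 := by
  classical
  refine ⟨fun q' => ?_, fun i j j' l => ?_⟩
  · simp only [coeff_sub, coeff_sum, coeff_C_mul, hP, coeff_inr_generator, sub_self]
  · have hv : ∀ o, coeff (Finsupp.single (Sum.inl (Sum.inl (i, j)) : GraphVars n) 1 +
        Finsupp.single (Sum.inl (Sum.inr (j', l)) : GraphVars n) 1) (t o) =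
          -(if j = j' then coeff (Finsupp.single (Sum.inr (i, l) : GraphVars n) 1) (t o) else 0) :=
      fun o => coeffIdentity n (t o) (fun x hx => eval_eq_zero_of_mem_graphIdeal (ht o) hx) i j j' l
    have hg := coeffIdentity n (generator n q) (fun x hx => eval_generator_of_mem hx q) i j j' l
    simp only [coeff_sub, coeff_sum, coeff_C_mul, hv, hg]
    by_cases hjj : j = j'
    · simp only [hjj, if_true, mul_neg, Finset.sum_neg_distrib, hP, coeff_inr_generator, sub_self]
    · simp only [hjj, if_false, mul_zero, Finset.sum_const_zero, neg_zero, sub_self]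

/-- **THE e = 3 RUNG WITH EXACT AFFINE SECTIONS — garbage-free.**  Tests `t_o ∈ I` of nonscalar length
`≤ N`; cost-free affine fields `ξ₁`, `ξ₂` that are EXACT kernel sections of the row matrices of `t` resp.
`t ∪ D_{ξ₁}t`; exact cube members with unit multipliers; and per coordinate: alive (`ξ₁,q(0) ξ₂,q(0) ≠ 0`) or
ROW-FORCED in the level-1 row matrix at `0`.  Then `R(⟨n,n,n⟩) ≤ 18N`. -/
theorem tensorRank_le_of_cubeMembers_exactAffine {N T : ℕ} (t : Fin T → MvPolynomial (GraphVars n) ℂ)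
    (hspan : ∃ gs : List (MvPolynomial (GraphVars n) ℂ), IsNonscalarSeq gs ∧ gs.length ≤ N ∧
      ∀ o, t o ∈ freeSpan {q | q ∈ gs})
    (ht : ∀ o, t o ∈ graphIdeal n)
    (ξ₁ ξ₂ : Fin n × Fin n → MvPolynomial (MatMulVars n) ℂ)
    (hξ₁ : ∀ q, liftAB n (ξ₁ q) ∈ freeSpan (∅ : Set (MvPolynomial (GraphVars n) ℂ)))
    (hξ₂ : ∀ q, liftAB n (ξ₂ q) ∈ freeSpan (∅ : Set (MvPolynomial (GraphVars n) ℂ)))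
    (hker₁ : ∀ o, ∑ q, ξ₁ q * rowPoly (t o) q = 0)
    (hker₂ : ∀ o : Fin T ⊕ Fin T, ∑ q, ξ₂ q * rowPoly (Sum.elim t (fun o => derivC ξ₁ (t o)) o) q = 0)
    (hcube : ∀ q : Fin n × Fin n, ∃ (g : MvPolynomial (MatMulVars n) ℂ)
      (h : Fin T → MvPolynomial (GraphVars n) ℂ), coeff 0 g ≠ 0 ∧
        ∑ o, h o * t o = liftAB n g * generator n q ^ 3)
    (hq : ∀ q : Fin n × Fin n, (coeff 0 (ξ₁ q) ≠ 0 ∧ coeff 0 (ξ₂ q) ≠ 0) ∨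
      ∃ P : Fin T ⊕ Fin T → ℂ, ∀ q' : Fin n × Fin n,
        ∑ o, P o * coeff (Finsupp.single (Sum.inr q' : GraphVars n) 1)
          (Sum.elim t (fun o => derivC ξ₁ (t o)) o) = if q = q' then 1 else 0) :
    tensorRank (matMulTensor ℂ n n n) ≤ 2 * (9 * N) := by
  classical
  set p₁ : Fin T ⊕ Fin T → MvPolynomial (GraphVars n) ℂ := Sum.elim t fun o => derivC ξ₁ (t o) with hp₁
  -- every level-1 output lies in `I` (exactness of `ξ₁`), hence so does every level-2 output
  have hD₁ : ∀ o, derivC ξ₁ (t o) ∈ graphIdeal n := fun o =>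
    derivC_mem_graphIdeal_of_exact ξ₁ (t o) (hker₁ o)
  have hp₁I : ∀ o, p₁ o ∈ graphIdeal n := by
    rintro (o | o)
    · exact ht o
    · exact hD₁ o
  have hD₂ : ∀ o : Fin T ⊕ Fin T, derivC ξ₂ (p₁ o) ∈ graphIdeal n := fun o =>
    derivC_mem_graphIdeal_of_exact ξ₂ (p₁ o) (hker₂ o)
  refine tensorRank_le_of_cubeMembers_affine2 t hspan ht ξ₁ ξ₂ hξ₁ hξ₂
    (fun o => coeff_zero_eq_zero_of_mem_graphIdeal (hD₁ o))
    (fun o v => coeff_single_inl_eq_zero_of_mem_graphIdeal (hD₁ o) v)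
    (fun o => ⟨?_, ?_⟩) (fun o v => ⟨?_, ?_⟩) fun q => ?_
  · simpa only [hp₁, Sum.elim_inl] using coeff_zero_eq_zero_of_mem_graphIdeal (hD₂ (Sum.inl o))
  · simpa only [hp₁, Sum.elim_inr] using coeff_zero_eq_zero_of_mem_graphIdeal (hD₂ (Sum.inr o))
  · simpa only [hp₁, Sum.elim_inl] using coeff_single_inl_eq_zero_of_mem_graphIdeal (hD₂ (Sum.inl o)) v
  · simpa only [hp₁, Sum.elim_inr] using coeff_single_inl_eq_zero_of_mem_graphIdeal (hD₂ (Sum.inr o)) v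
  · rcases hq q with ⟨h1, h2⟩ | ⟨P, hP⟩
    · exact Or.inl ⟨h1, h2, hcube q⟩
    · obtain ⟨hrc, hrab⟩ := oscNull_of_rowEq' p₁ hp₁I P q (by simpa only [hp₁] using hP)
      refine Or.inr ⟨fun o => P (Sum.inl o), fun o => P (Sum.inr o), fun _ => 0, fun _ => 0,
        ∑ o, C (P o) * p₁ o - generator n q, hrc, hrab, ?_⟩
      rw [Fintype.sum_sum_type]
      simp only [hp₁, Sum.elim_inl, Sum.elim_inr, map_zero, zero_mul, Finset.sum_const_zero, add_zero]
      ring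

end Summit.MatrixMultiplication.MatrixMultiplication.Theorems.GraphEquations

end
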